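import Mathlib.Analysis.SpecialFunctions.Pow.Real
import Mathlib.Analysis.SpecialFunctions.Log.Basic
import Mathlib.Analysis.Complex.ExponentialBounds
import Mathlib.Algebra.Order.Floor.Semiring
import Mathlib.Data.Nat.Factorial.Basic
import Mathlib.Tactic.Positivity
import Mathlib.Tactic.FieldSimp
import Mathlib.Tactic.Ring
import Mathlib.Tactic.Linarith
import Mathlib.Tactic.GCongr
import HarnessLib

/-!
# Parameter inequalities for LP92 Theorem 6.1

Real-variable bookkeeping for the proof of Theorem 6.1 of H. W. Lenstra Jr. and C. Pomerance,
*A rigorous time bound for factoring integers*, J. Amer. Math. Soc. **5** (1992) 483–516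
(pp. 499–500). With `X = log x`, `L₂ = log log x`, `Y = log y`, `u = X / Y`, `L = log u`,
`v = y^{1-1/L}`, `w = v^{L^{-η}}` the paper needs:

* (6.5) `log u ≥ (2/5) log log x ≥ 3` once `x ≥ c₅` and `2 ≤ y ≤ exp((log x)^{1/2}(log log x)^η)`;
  we take the explicit, effectively computable `c₅ = exp (exp 70)` (`logu_lower_bound`);
* (6.7) `log (x/m) ≤ (2u / log u) log v` for `m ≥ v^{u-1}` (`log_quot_le`);
* the final estimate `log w ≤ (25/4) u (log u)^η` (`logw_le`);
* the two exponential lower bounds fed by the counting lemmas: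
  `(1/(uαL))^{[u]} ≥ exp(-u(L + log L + log α))` (`inv_pow_floor_ge_exp`) and the case analysis
  `A^{[l]}/[l]! ≥ (A/l)^l / w` for `l ≥ 1` (`pow_floor_div_factorial_ge`).

Only elementary calculus facts from Mathlib are used (`Real.add_one_le_exp`,
`Real.quadratic_le_exp_of_nonneg`, `Real.sum_le_exp_of_nonneg`). Everything is proved; this
file introduces no definitions and no named facts.
-/

namespace Literature.NumberTheory.Sieve
namespace LenstraPomerance

open Real Finset

/-! ### (6.5): the size of `u` -/

/-- `log t ≤ t / 10` for `t ≥ 70` (used with `t = log log x`). [folklore] -/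
theorem log_le_div_ten {t : ℝ} (ht : 70 ≤ t) : Real.log t ≤ t / 10 := by
  have ht0 : 0 < t := by linarith
  rw [Real.log_le_iff_le_exp ht0]
  set s := t / 10 with hs
  have hs7 : 7 ≤ s := by rw [hs]; linarith
  have hs0 : 0 ≤ s := by linarith
  have hsum := Real.sum_le_exp_of_nonneg hs0 5
  simp only [sum_range_succ, sum_range_zero, Nat.factorial, Nat.succ_eq_add_one, Nat.cast_ofNat,
    pow_succ, pow_zero, Nat.cast_one, Nat.cast_mul, Nat.cast_add] at hsum
  have h3 : (240 : ℝ) ≤ s * s * s := by nlinarith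
  nlinarith [hsum, h3]

/-- The explicit constant `c₅ = exp (exp 70)` of Theorem 6.1 (any larger value works).
For `x ≥ c₅`: `log log x ≥ 70`. [cite: LenstraPomerance1992, Theorem 6.1 (6.2)] -/
theorem seventy_le_loglog {x : ℝ} (hx : Real.exp (Real.exp 70) ≤ x) :
    70 ≤ Real.log (Real.log x) := by
  have h1 : Real.exp 70 ≤ Real.log x := by
    rw [Real.le_log_iff_exp_le (lt_of_lt_of_le (Real.exp_pos _) hx)]
    exact hx
  rw [Real.le_log_iff_exp_le (lt_of_lt_of_le (Real.exp_pos _) h1)]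
  exact h1

/-- **(6.5)** in quantitative form. For `x ≥ exp (exp 70)`, `η ≤ 1` and
`2 ≤ y ≤ exp ((log x)^{1/2} (log log x)^η)`, the quantity `u = log x / log y` satisfies
`u ≥ (log x)^{1/2} / (log log x)^η` and `log u ≥ (2/5) log log x` (in particular `log u ≥ 28`).
[cite: LenstraPomerance1992, §6 (proof of Theorem 6.1, (6.5))] -/
theorem logu_lower_bound {x y η : ℝ} (hη1 : η ≤ 1)
    (hx : Real.exp (Real.exp 70) ≤ x) (hy2 : 2 ≤ y)
    (hy : y ≤ Real.exp (Real.log x ^ (1 / 2 : ℝ) * Real.log (Real.log x) ^ η)) :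
    0 < Real.log y ∧
    Real.log y ≤ Real.log x ^ (1 / 2 : ℝ) * Real.log (Real.log x) ^ η ∧
    Real.log x ^ (1 / 2 : ℝ) / Real.log (Real.log x) ^ η ≤ Real.log x / Real.log y ∧
    (2 / 5) * Real.log (Real.log x) ≤ Real.log (Real.log x / Real.log y) := by
  set X := Real.log x with hX
  set L₂ := Real.log X with hL₂
  set Y := Real.log y with hY
  have hL₂70 : 70 ≤ L₂ := seventy_le_loglog hx
  have hX0 : 0 < X := by
    have : Real.exp 70 ≤ X := by
      rw [hX, Real.le_log_iff_exp_le (lt_of_lt_of_le (Real.exp_pos _) hx)]; exact hx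
    exact lt_of_lt_of_le (Real.exp_pos _) this
  have hy0 : 0 < y := by linarith
  have hY0 : 0 < Y := Real.log_pos (by linarith)
  have hYle : Y ≤ X ^ (1 / 2 : ℝ) * L₂ ^ η := by
    rw [hY, Real.log_le_iff_le_exp hy0]; exact hy
  have hL₂pos : 0 < L₂ := by linarith
  have hL₂η : 0 < L₂ ^ η := Real.rpow_pos_of_pos hL₂pos η
  have hsqrt : 0 < X ^ (1 / 2 : ℝ) := Real.rpow_pos_of_pos hX0 _
  -- u ≥ X^{1/2} / L₂^η
  have hu : X ^ (1 / 2 : ℝ) / L₂ ^ η ≤ X / Y := by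
    rw [div_le_div_iff₀ hL₂η hY0]
    calc X ^ (1 / 2 : ℝ) * Y ≤ X ^ (1 / 2 : ℝ) * (X ^ (1 / 2 : ℝ) * L₂ ^ η) :=
          mul_le_mul_of_nonneg_left hYle hsqrt.le
      _ = X * L₂ ^ η := by
          rw [← mul_assoc, ← Real.rpow_add hX0]; norm_num
  refine ⟨hY0, hYle, hu, ?_⟩
  -- log u ≥ log (X^{1/2} / L₂^η) = L₂/2 - η log L₂ ≥ L₂/2 - L₂/10
  have hlogL₂ : 0 ≤ Real.log L₂ := Real.log_nonneg (by linarith)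
  have h1 : Real.log (X ^ (1 / 2 : ℝ) / L₂ ^ η) = (1 / 2) * L₂ - η * Real.log L₂ := by
    rw [Real.log_div hsqrt.ne' hL₂η.ne', Real.log_rpow hX0, Real.log_rpow hL₂pos]
  have h2 : Real.log (X ^ (1 / 2 : ℝ) / L₂ ^ η) ≤ Real.log (X / Y) :=
    Real.log_le_log (div_pos hsqrt hL₂η) hu
  have h3 : η * Real.log L₂ ≤ L₂ / 10 :=
    (mul_le_of_le_one_left hlogL₂ hη1).trans (log_le_div_ten hL₂70)
  linarith

/-! ### The exponents `1 - 1/L` and `L^{-η}`; the numbers `v` and `w` -/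

/-- For `L ≥ 4`: `0 < 1 - 1/L ≤ 1`. [cite: LenstraPomerance1992, §6 (6.3)] -/
theorem one_sub_inv_pos_le {L : ℝ} (hL : 4 ≤ L) : 0 < 1 - 1 / L ∧ 1 - 1 / L ≤ 1 := by
  have hL0 : 0 < L := by linarith
  constructor
  · rw [sub_pos, div_lt_one hL0]; linarith
  · have : 0 ≤ 1 / L := by positivity
    linarith

/-- For `L ≥ 1` and `η ≥ 0`: `0 < L^{-η} ≤ 1`. [cite: LenstraPomerance1992, §6 (6.3)] -/
theorem rpow_neg_pos_le_one {L η : ℝ} (hL : 1 ≤ L) (hη : 0 ≤ η) :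
    0 < L ^ (-η) ∧ L ^ (-η) ≤ 1 := by
  have hL0 : 0 < L := by linarith
  refine ⟨Real.rpow_pos_of_pos hL0 _, ?_⟩
  calc L ^ (-η) ≤ L ^ (0 : ℝ) := Real.rpow_le_rpow_of_exponent_le hL (by linarith)
    _ = 1 := Real.rpow_zero _

/-- `v = y^{1-1/L}` and `w = v^{L^{-η}}`: for `y ≥ 2`, `L ≥ 4`, `η ≥ 0` one has
`1 < w ≤ v ≤ y`, `log v = (1 - 1/L) log y > 0` and `log w = L^{-η} log v > 0`.
[cite: LenstraPomerance1992, §6 (6.3) and "Since w ≤ v" (p. 499)] -/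
theorem v_w_bounds {y L η v w : ℝ} (hy : 2 ≤ y) (hL : 4 ≤ L) (hη : 0 ≤ η)
    (hv : v = y ^ (1 - 1 / L)) (hw : w = v ^ (L ^ (-η))) :
    1 < v ∧ v ≤ y ∧ Real.log v = (1 - 1 / L) * Real.log y ∧ 0 < Real.log v ∧
    1 < w ∧ w ≤ v ∧ Real.log w = L ^ (-η) * Real.log v ∧ 0 < Real.log w := by
  subst hv
  subst hw
  set v := y ^ (1 - 1 / L) with hv
  set w := v ^ (L ^ (-η)) with hw
  have hy1 : 1 < y := by linarith
  have hy0 : 0 < y := by linarith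
  obtain ⟨he0, he1⟩ := one_sub_inv_pos_le hL
  obtain ⟨hf0, hf1⟩ := rpow_neg_pos_le_one (show (1 : ℝ) ≤ L by linarith) hη
  have hv1 : 1 < v := Real.one_lt_rpow hy1 he0
  have hvy : v ≤ y := by
    calc v ≤ y ^ (1 : ℝ) := Real.rpow_le_rpow_of_exponent_le hy1.le he1
      _ = y := Real.rpow_one y
  have hlogv : Real.log v = (1 - 1 / L) * Real.log y := Real.log_rpow hy0 _
  have hlogv0 : 0 < Real.log v := Real.log_pos hv1
  have hv0 : 0 < v := by linarith
  have hw1 : 1 < w := Real.one_lt_rpow hv1 hf0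
  have hwv : w ≤ v := by
    calc w ≤ v ^ (1 : ℝ) := Real.rpow_le_rpow_of_exponent_le hv1.le hf1
      _ = v := Real.rpow_one v
  have hlogw : Real.log w = L ^ (-η) * Real.log v := Real.log_rpow hv0 _
  exact ⟨hv1, hvy, hlogv, hlogv0, hw1, hwv, hlogw, Real.log_pos hw1⟩

/-! ### (6.7): `log (x/m) ≤ (2u / log u) · log v` -/

/-- The elementary inequality behind (6.7): for `L ≥ 4` and `u ≥ 1 + L + L²/2` (true for
`u = e^L`), `L² - L ≤ u (L - 2)`. [cite: LenstraPomerance1992, §6 (proof of Theorem 6.1, (6.7))] -/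
theorem sq_sub_le_mul_sub_two {L u : ℝ} (hL : 4 ≤ L) (hu : 1 + L + L ^ 2 / 2 ≤ u) :
    L ^ 2 - L ≤ u * (L - 2) := by
  nlinarith

/-- **(6.7).** With `X = log x = u · Y`, `Y = log y > 0`, `L = log u ≥ 4` (and `u = e^L`),
`log v = (1 - 1/L) Y`: if `log m ≥ (u - 1) log v` (i.e. `m ≥ v^{u-1}`), then
`log (x/m) = X - log m ≤ (2u/L) log v`.
[cite: LenstraPomerance1992, §6 (proof of Theorem 6.1, (6.7))] -/
theorem log_quot_le {X Y u L logv logm : ℝ} (hY : 0 < Y) (hXu : X = u * Y)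
    (hL : 4 ≤ L) (huL : Real.exp L = u) (hlogv : logv = (1 - 1 / L) * Y)
    (hm : (u - 1) * logv ≤ logm) :
    X - logm ≤ 2 * u / L * logv := by
  have hL0 : 0 < L := by linarith
  have hu : 1 + L + L ^ 2 / 2 ≤ u := by
    rw [← huL]; exact Real.quadratic_le_exp_of_nonneg (by linarith)
  have hkey : L ^ 2 - L ≤ u * (L - 2) := sq_sub_le_mul_sub_two hL hu
  have hu0 : 0 < u := by nlinarith
  -- reduce to the polynomial inequality
  have h1 : X - logm ≤ u * Y - (u - 1) * ((1 - 1 / L) * Y) := by rw [hXu, ← hlogv]; linarith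
  have h2 : u * Y - (u - 1) * ((1 - 1 / L) * Y) ≤ 2 * u / L * ((1 - 1 / L) * Y) := by
    rw [← sub_nonneg]
    have : 2 * u / L * ((1 - 1 / L) * Y) - (u * Y - (u - 1) * ((1 - 1 / L) * Y))
        = (Y / L ^ 2) * (u * (L - 2) - (L ^ 2 - L)) := by
      field_simp
      ring
    rw [this]
    exact mul_nonneg (by positivity) (by linarith)
  calc X - logm ≤ u * Y - (u - 1) * ((1 - 1 / L) * Y) := h1
    _ ≤ 2 * u / L * ((1 - 1 / L) * Y) := h2
    _ = 2 * u / L * logv := by rw [hlogv]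

/-! ### The final estimate `log w ≤ (25/4) u (log u)^η` -/

/-- For `0 ≤ a ≤ 5/2 · b`, `b > 0`, `0 ≤ η ≤ 1`: `a^η ≤ (5/2) b^η`. [folklore] -/
theorem rpow_le_five_halves_mul_rpow {a b η : ℝ} (ha : 0 ≤ a) (hb : 0 < b)
    (hab : a ≤ 5 / 2 * b) (hη0 : 0 ≤ η) (hη1 : η ≤ 1) : a ^ η ≤ 5 / 2 * b ^ η := by
  calc a ^ η ≤ (5 / 2 * b) ^ η := Real.rpow_le_rpow ha hab hη0
    _ = (5 / 2) ^ η * b ^ η := Real.mul_rpow (by norm_num) hb.le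
    _ ≤ (5 / 2) ^ (1 : ℝ) * b ^ η :=
        mul_le_mul_of_nonneg_right
          (Real.rpow_le_rpow_of_exponent_le (by norm_num : (1 : ℝ) ≤ 5 / 2) hη1)
          (Real.rpow_pos_of_pos hb η).le
    _ = 5 / 2 * b ^ η := by rw [Real.rpow_one]

/-- **`log w ≤ (25/4) · u · (log u)^η`** (last display of the proof, p. 500): with
`log w = L^{-η} (1 - 1/L) Y`, `Y ≤ X^{1/2} L₂^η`, `X^{1/2} ≤ u L₂^η`, `L₂ ≤ (5/2) L`, `L ≥ 4`,
`0 ≤ η ≤ 1`. [cite: LenstraPomerance1992, §6 (proof of Theorem 6.1, p. 500)] -/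
theorem logw_le {X Y u L L₂ η logw : ℝ} (hη0 : 0 ≤ η) (hη1 : η ≤ 1) (hL : 4 ≤ L)
    (hL₂0 : 0 < L₂) (hL₂ : L₂ ≤ 5 / 2 * L) (hY0 : 0 < Y)
    (hY : Y ≤ X ^ (1 / 2 : ℝ) * L₂ ^ η) (hX0 : 0 < X)
    (hu : X ^ (1 / 2 : ℝ) ≤ u * L₂ ^ η) (hu0 : 0 < u)
    (hlogw : logw = L ^ (-η) * ((1 - 1 / L) * Y)) :
    logw ≤ 25 / 4 * u * L ^ η := by
  have hL0 : 0 < L := by linarith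
  obtain ⟨he0, he1⟩ := one_sub_inv_pos_le hL
  obtain ⟨hf0, hf1⟩ := rpow_neg_pos_le_one (show (1 : ℝ) ≤ L by linarith) hη0
  have hLη : 0 < L ^ η := Real.rpow_pos_of_pos hL0 η
  have hL₂η : 0 < L₂ ^ η := Real.rpow_pos_of_pos hL₂0 η
  have hsqrt : 0 < X ^ (1 / 2 : ℝ) := Real.rpow_pos_of_pos hX0 _
  -- Step 1: logw ≤ L^{-η} * Y
  have h1 : logw ≤ L ^ (-η) * Y := by
    rw [hlogw]
    exact mul_le_mul_of_nonneg_left (mul_le_of_le_one_left hY0.le he1) hf0.le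
  -- Step 2: L^{-η} * Y ≤ X^{1/2} * (L₂/L)^η... ≤ (5/2) X^{1/2}
  have h2 : L ^ (-η) * L₂ ^ η ≤ 5 / 2 := by
    have : L ^ (-η) * L₂ ^ η = (L₂ / L) ^ η := by
      rw [Real.div_rpow hL₂0.le hL0.le, Real.rpow_neg hL0.le, div_eq_mul_inv, mul_comm]
    rw [this]
    have hq : L₂ / L ≤ 5 / 2 := by rw [div_le_iff₀ hL0]; linarith
    calc (L₂ / L) ^ η ≤ (5 / 2) ^ η := Real.rpow_le_rpow (by positivity) hq hη0
      _ ≤ (5 / 2) ^ (1 : ℝ) := Real.rpow_le_rpow_of_exponent_le (by norm_num) hη1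
      _ = 5 / 2 := Real.rpow_one _
  have h3 : L ^ (-η) * Y ≤ 5 / 2 * X ^ (1 / 2 : ℝ) := by
    calc L ^ (-η) * Y ≤ L ^ (-η) * (X ^ (1 / 2 : ℝ) * L₂ ^ η) :=
          mul_le_mul_of_nonneg_left hY hf0.le
      _ = (L ^ (-η) * L₂ ^ η) * X ^ (1 / 2 : ℝ) := by ring
      _ ≤ 5 / 2 * X ^ (1 / 2 : ℝ) := mul_le_mul_of_nonneg_right h2 hsqrt.le
  -- Step 3: X^{1/2} ≤ u L₂^η ≤ u (5/2) L^η
  have h4 : L₂ ^ η ≤ 5 / 2 * L ^ η := rpow_le_five_halves_mul_rpow hL₂0.le hL0 hL₂ hη0 hη1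
  have h5 : X ^ (1 / 2 : ℝ) ≤ u * (5 / 2 * L ^ η) :=
    hu.trans (mul_le_mul_of_nonneg_left h4 hu0.le)
  calc logw ≤ L ^ (-η) * Y := h1
    _ ≤ 5 / 2 * X ^ (1 / 2 : ℝ) := h3
    _ ≤ 5 / 2 * (u * (5 / 2 * L ^ η)) := by gcongr
    _ = 25 / 4 * u * L ^ η := by ring

/-! ### Exponential lower bounds used with the counting lemmas -/

/-- `k! ≤ t^k` for `k ≤ t` (from `k! ≤ k^k`). [folklore] -/
theorem factorial_le_rpow_of_le {k : ℕ} {t : ℝ} (hk : (k : ℝ) ≤ t) :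
    (k.factorial : ℝ) ≤ t ^ k := by
  have h1 : (k.factorial : ℝ) ≤ (k : ℝ) ^ k := by exact_mod_cast Nat.factorial_le_pow k
  exact h1.trans (pow_le_pow_left₀ (Nat.cast_nonneg k) hk k)

/-- **`(1/(α log u))^{[u]} / [u]! ≥ exp (-u (log u + log log u + log α))`** (third display on
p. 500): for `u ≥ 1`, `L = log u ≥ 1`, `α ≥ 1` and `k = [u]`.
[cite: LenstraPomerance1992, §6 (proof of Theorem 6.1, p. 500)] -/
theorem inv_pow_floor_div_factorial_ge_exp {u L α : ℝ} (hu : 1 ≤ u) (hL : 1 ≤ L)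
    (huL : Real.log u = L) (hα : 1 ≤ α) :
    Real.exp (-(u * (L + Real.log L + Real.log α))) ≤
      (1 / (α * L)) ^ ⌊u⌋₊ / (⌊u⌋₊.factorial : ℝ) := by
  set k := ⌊u⌋₊ with hk
  have hu0 : 0 < u := by linarith
  have hku : (k : ℝ) ≤ u := Nat.floor_le hu0.le
  have hαL : 1 ≤ α * L := by nlinarith
  have hb0 : 0 < 1 / (u * α * L) := by positivity
  have hb1 : 1 / (u * α * L) ≤ 1 := by
    rw [div_le_one (by positivity)]; nlinarith
  -- (1/(αL))^k / k! ≥ (1/(αL))^k / u^k = (1/(uαL))^k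
  have hfact : (k.factorial : ℝ) ≤ u ^ k := factorial_le_rpow_of_le hku
  have hfact0 : (0 : ℝ) < k.factorial := by exact_mod_cast Nat.factorial_pos k
  have step1 : (1 / (u * α * L)) ^ k ≤ (1 / (α * L)) ^ k / (k.factorial : ℝ) := by
    rw [le_div_iff₀ hfact0]
    calc (1 / (u * α * L)) ^ k * k.factorial ≤ (1 / (u * α * L)) ^ k * u ^ k :=
          mul_le_mul_of_nonneg_left hfact (by positivity)
      _ = (1 / (α * L)) ^ k := by
          rw [← mul_pow]; congr 1; field_simp
  -- (1/(uαL))^k ≥ (1/(uαL))^u = exp(-u log(uαL))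
  have step2 : (1 / (u * α * L)) ^ u ≤ (1 / (u * α * L)) ^ k := by
    rw [← Real.rpow_natCast]
    exact Real.rpow_le_rpow_of_exponent_ge hb0 hb1 hku
  have step3 : (1 / (u * α * L)) ^ u = Real.exp (-(u * (L + Real.log L + Real.log α))) := by
    rw [Real.rpow_def_of_pos hb0, one_div, Real.log_inv, Real.log_mul (by positivity) (by positivity),
      Real.log_mul (by positivity) (by positivity), huL]
    congr 1; ring
  calc Real.exp (-(u * (L + Real.log L + Real.log α))) = (1 / (u * α * L)) ^ u := step3.symm
    _ ≤ (1 / (u * α * L)) ^ k := step2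
    _ ≤ (1 / (α * L)) ^ k / (k.factorial : ℝ) := step1

/-- **The case `l(m) ≥ 1` on p. 500**: for `0 < A ≤ w`, `1 ≤ w`, `l ≥ 1` and `k = [l]`,
`A^k / k! ≥ (A/l)^l / w` (from `k! ≤ k^k ≤ l^k` and `(A/l)^{l-k} ≤ max(1, A) ≤ w`).
[cite: LenstraPomerance1992, §6 (proof of Theorem 6.1, p. 500)] -/
theorem pow_floor_div_factorial_ge {A w l : ℝ} (hA0 : 0 < A) (hAw : A ≤ w) (hw : 1 ≤ w)
    (hl : 1 ≤ l) : (A / l) ^ l / w ≤ A ^ ⌊l⌋₊ / (⌊l⌋₊.factorial : ℝ) := by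
  set k := ⌊l⌋₊ with hk
  have hl0 : 0 < l := by linarith
  have hkl : (k : ℝ) ≤ l := Nat.floor_le hl0.le
  have hlk : l < k + 1 := Nat.lt_floor_add_one l
  have hb0 : 0 < A / l := div_pos hA0 hl0
  have hw0 : 0 < w := by linarith
  have hfact0 : (0 : ℝ) < k.factorial := by exact_mod_cast Nat.factorial_pos k
  -- A^k / k! ≥ (A/l)^k
  have step1 : (A / l) ^ k ≤ A ^ k / (k.factorial : ℝ) := by
    rw [le_div_iff₀ hfact0, div_pow]
    calc A ^ k / l ^ k * k.factorial ≤ A ^ k / l ^ k * l ^ k := by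
          gcongr
          exact factorial_le_rpow_of_le hkl
      _ = A ^ k := by field_simp
  -- (A/l)^l = (A/l)^k * (A/l)^(l-k) ≤ (A/l)^k * w
  have hsplit : (A / l) ^ l = (A / l) ^ k * (A / l) ^ (l - k) := by
    rw [← Real.rpow_natCast, ← Real.rpow_add hb0]; congr 1; ring
  have hrest : (A / l) ^ (l - k) ≤ w := by
    rcases le_or_gt (A / l) 1 with hle | hlt
    · exact (Real.rpow_le_one hb0.le hle (by linarith)).trans hw
    · calc (A / l) ^ (l - k) ≤ (A / l) ^ (1 : ℝ) :=
            Real.rpow_le_rpow_of_exponent_le hlt.le (by linarith)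
        _ = A / l := Real.rpow_one _
        _ ≤ A := div_le_self hA0.le hl
        _ ≤ w := hAw
  calc (A / l) ^ l / w = (A / l) ^ k * ((A / l) ^ (l - k) / w) := by rw [hsplit]; ring
    _ ≤ (A / l) ^ k * 1 := by
        gcongr
        rwa [div_le_one hw0]
    _ = (A / l) ^ k := mul_one _
    _ ≤ A ^ k / (k.factorial : ℝ) := step1

/-- **From `(A/l)^l` to (6.10)**, the case `l(m) ≥ 1`: with `A = w / (β log w)`,
`Λ = log (x/m) = l · log w ≤ X = log x`, `log X = L₂ ≤ (5/2) L` and (6.8)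
`l ≤ 2 u L^{η-1}`, one has `e^Λ · exp(-(5uL^η + 2uL^{η-1} log β)) ≤ (A/l)^l`, because
`l log (A/l) = Λ - l log β - l log Λ` and (6.9) `l log Λ ≤ 2uL^{η-1} log log x ≤ 5 u L^η`.
[cite: LenstraPomerance1992, §6 (proof of Theorem 6.1, (6.8)–(6.10))] -/
theorem exp_mul_exp_neg_le_rpow {w β u L η X L₂ Λ l : ℝ} (hw1 : 1 < w) (hβ : 1 ≤ β)
    (hL0 : 0 < L) (hu0 : 0 ≤ u) (hΛX : Λ ≤ X) (hL₂ : Real.log X = L₂) (hL₂L : L₂ ≤ 5 / 2 * L)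
    (hlΛ : l * Real.log w = Λ) (hl1 : 1 ≤ l) (hl : l ≤ 2 * u * L ^ (η - 1)) :
    Real.exp Λ * Real.exp (-(5 * u * L ^ η + 2 * u * L ^ (η - 1) * Real.log β))
      ≤ (w / (β * Real.log w) / l) ^ l := by
  have hlogw : 0 < Real.log w := Real.log_pos hw1
  have hl0 : 0 < l := by linarith
  have hΛ0 : 0 < Λ := by rw [← hlΛ]; positivity
  have hw0 : 0 < w := by linarith
  have hβ0 : 0 < β := by linarith
  have hA0 : 0 < w / (β * Real.log w) / l := by positivity
  rw [← Real.exp_add, Real.rpow_def_of_pos hA0, Real.exp_le_exp]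
  have hlog : Real.log (w / (β * Real.log w) / l) = Real.log w - Real.log β - Real.log Λ := by
    rw [Real.log_div (by positivity) hl0.ne', Real.log_div hw0.ne' (by positivity),
      Real.log_mul hβ0.ne' hlogw.ne', ← hlΛ, Real.log_mul hl0.ne' hlogw.ne']
    ring
  rw [hlog]
  have h1 : l * Real.log β ≤ 2 * u * L ^ (η - 1) * Real.log β :=
    mul_le_mul_of_nonneg_right hl (Real.log_nonneg hβ)
  have hLη1 : 0 < L ^ (η - 1) := Real.rpow_pos_of_pos hL0 _
  have hLη : 0 < L ^ η := Real.rpow_pos_of_pos hL0 _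
  have h2 : l * Real.log Λ ≤ 5 * u * L ^ η := by
    have h5 : 0 ≤ 5 * u * L ^ η := by positivity
    rcases le_or_gt Λ 1 with hΛ1 | hΛ1
    · have : Real.log Λ ≤ 0 := Real.log_nonpos hΛ0.le hΛ1
      nlinarith
    · have hlogΛ : Real.log Λ ≤ 5 / 2 * L := by
        calc Real.log Λ ≤ Real.log X := Real.log_le_log hΛ0 hΛX
          _ = L₂ := hL₂
          _ ≤ 5 / 2 * L := hL₂L
      have hLηL : L ^ (η - 1) * L = L ^ η := by
        rw [Real.rpow_sub_one hL0.ne']; field_simp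
      calc l * Real.log Λ ≤ l * (5 / 2 * L) := mul_le_mul_of_nonneg_left hlogΛ hl0.le
        _ ≤ 2 * u * L ^ (η - 1) * (5 / 2 * L) :=
            mul_le_mul_of_nonneg_right hl (by positivity)
        _ = 5 * u * (L ^ (η - 1) * L) := by ring
        _ = 5 * u * L ^ η := by rw [hLηL]
  nlinarith [h1, h2, hlΛ]

end LenstraPomerance
end Literature.NumberTheory.Sieve
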